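import Literature.Algebra.Homology.InducedModuleTwistedCoinvariants
import Mathlib.LinearAlgebra.Pi
import HarnessLib

/-!
# From a finite direct PRODUCT decomposition permuted by the group (Brown III (5.8): `V ≅ ∏_i A_i`, `ker(π_{gi} ∘ g) = ker π_i`) to the
# internal direct SUM of the coordinate submodules `V = ⊕_i M_i`, `M_i = ⋂_{j ≠ i} ker π_j`, `g M_i ⊆ M_{g i}` (Brown III (5.3)) — the input of
# Shapiro's lemma for the `χ`-coinvariants (`InducedModuleTwistedCoinvariants`); componentwise submodules `∏_i B_i` inherit the decomposition

Topic `Algebra/Homology`; namespace `Literature.Algebra.Homology.InducedModule`.  Sequel of `InducedModuleTwistedCoinvariants` (Shapiro's lemma in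
degree `0` with a character for `V = ⊕ M_i` permuted transitively: `shapiroEquiv`) and companion of the tree's `CoinducedModuleRecognition` (Brown
III (5.8): a `G`-module with a direct PRODUCT decomposition whose factors are permuted transitively is CO-induced).  For a FINITE index set the two
recognitions meet (`Ind = Coind`, Brown III (5.9)); this file is the elementary passage from the product data — a family of projections
`π_i : V → A_i` with `(π_i)_i : V → ∏_i A_i` bijective and `ker(π_{g i} ∘ g) = ker π_i` (exactly the shape proved for the semi-local units
`∏_{w∣v} 𝒪_wˣ` in `SemiLocalUnitGroupShapiro`: `bijective_pi_unitGroupProj`, `ker_unitGroupProj_smul`) — to the sum data consumed by `shapiroEquiv`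
(`M : I → Submodule k V`, `hperm : (M i).map (N g) ≤ M (g • i)`, `DirectSum.IsInternal M`).  Definitions with bodies and theorems; Mathlib + the
sibling only; NO named fact, no `sorry`, no instance, no notation.

* §1 `coordSummand π i = ⨅_{j ≠ i} ker π_j` (the elements supported at `i`), `mem_coordSummand_iff`, ★ `coordSummand_map_le` (`g M_i ⊆ M_{g i}` from
  `ker(π_{g j} ∘ g) = ker π_j`), ★ **`isInternal_coordSummand`** (`V = ⊕_i M_i` for `I` finite and `(π_i)_i` bijective: independence by applying the
  `π_j`, generation by lifting the single-coordinate vectors), `exists_mem_coordSummand_pi_eq` (the lift `v_i ∈ M_i` of `π_i v`).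
* §2 componentwise submodules: for `B_i ≤ A_i`, `piComap π B = ⋂_i π_i⁻¹(B_i)` ("`∏_i B_i`", e.g. the PRINCIPAL units `∏_w U¹_w ≤ ∏_w 𝒪_wˣ`) with
  the restricted projections `piComapProj`; ★ `bijective_pi_piComapProj`, ★ `ker_piComapProj_comp_eq` (the two hypotheses are inherited, for the
  restricted action `piComapRep` when `g B_i ⊆ B_{g i}` in the sense `π_{g i}(g v) ∈ B_{g i}` whenever `π_i v ∈ B_i`).

## References
* K. S. Brown, *Cohomology of Groups*, GTM 87, Springer (1982), III §5 Prop. (5.3), (5.8), (5.9). [Brown1982CohomologyGroups]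
* D. Harari, *Galois Cohomology and Class Field Theory* (2020), §13.1 (`U_K(v) = ∏_{w∣v} U_{K,w} = I_G^{G_v}(U_{K,v})`). [Harari2020]
-/

noncomputable section

universe u

namespace Literature.Algebra.Homology

namespace InducedModule

open Representation DirectSum

variable {k G : Type u} [CommRing k] [Group G] {V : Type u} [AddCommGroup V] [Module k V] (N : Representation k G V)
  {I : Type u} [MulAction G I] {A : I → Type u} [∀ i, AddCommGroup (A i)] [∀ i, Module k (A i)] (π : ∀ i, V →ₗ[k] A i)

/-! ## §1. The coordinate submodules of a product decomposition -/

/-- **`M_i = ⋂_{j ≠ i} ker π_j`** — the elements of `V ≅ ∏_j A_j` supported at the coordinate `i` (for the semi-local units: the units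
`u = (u_w)_w` with `u_{w'} = 1` for `w' ≠ w`, i.e. the factor `𝒪_wˣ`). [cite: Brown1982CohomologyGroups, III §5 Prop. (5.3), (5.8)] -/
def coordSummand (i : I) : Submodule k V := ⨅ (j : I) (_ : j ≠ i), LinearMap.ker (π j)

omit [MulAction G I] in
/-- Membership: `v ∈ M_i ↔ π_j v = 0` for all `j ≠ i`. [cite: Brown1982CohomologyGroups, III §5 Prop. (5.8)] -/
theorem mem_coordSummand_iff (i : I) (v : V) : v ∈ coordSummand π i ↔ ∀ j, j ≠ i → π j v = 0 := by
  simp only [coordSummand, Submodule.mem_iInf, LinearMap.mem_ker]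

omit [MulAction G I] in
/-- `M_j ≤ ker π_i` for `j ≠ i`. [cite: Brown1982CohomologyGroups, III §5 Prop. (5.8)] -/
theorem coordSummand_le_ker {i j : I} (h : j ≠ i) : coordSummand π j ≤ LinearMap.ker (π i) := fun v hv =>
  LinearMap.mem_ker.mpr ((mem_coordSummand_iff π j v).mp hv i h.symm)

variable (hker : ∀ (g : G) (i : I), LinearMap.ker (π (g • i) ∘ₗ N g) = LinearMap.ker (π i))

include hker in
/-- ★ **`g M_i ⊆ M_{g i}`**: the group permutes the coordinate submodules (from `ker(π_{g j} ∘ g) = ker π_j`: for `j' ≠ g i`, `j' = g j` with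
`j ≠ i`, and `π_{g j}(g v) = 0` iff `π_j v = 0`). [cite: Brown1982CohomologyGroups, III §5 Prop. (5.3), (5.8)] -/
theorem coordSummand_map_le (g : G) (i : I) : (coordSummand π i).map (N g) ≤ coordSummand π (g • i) := by
  rintro _ ⟨v, hv, rfl⟩
  simp only [SetLike.mem_coe, mem_coordSummand_iff] at hv ⊢
  intro j' hj'
  have hj : g⁻¹ • j' ≠ i := fun h => hj' (by rw [← h, smul_inv_smul])
  have hmem : v ∈ LinearMap.ker (π (g • (g⁻¹ • j')) ∘ₗ N g) := by
    rw [hker]; exact LinearMap.mem_ker.mpr (hv _ hj)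
  rwa [smul_inv_smul, LinearMap.mem_ker, LinearMap.comp_apply] at hmem

variable (hbij : Function.Bijective (LinearMap.pi π))

omit [MulAction G I] in
include hbij in
/-- An element all of whose coordinates vanish is `0`. [cite: Brown1982CohomologyGroups, III §5 Prop. (5.8)] -/
theorem eq_zero_of_forall_pi_eq_zero {v : V} (hv : ∀ i, π i v = 0) : v = 0 :=
  hbij.1 (funext fun i => by rw [LinearMap.pi_apply, hv, map_zero, Pi.zero_apply])

section Finite

variable [DecidableEq I]

omit [MulAction G I] in
include hbij in
/-- **The lift of one coordinate**: for every `v` and `i` there is `v_i ∈ M_i` with `π_i v_i = π_i v` (the preimage of the single-coordinate vector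
`(0, …, π_i v, …, 0)` under `(π_j)_j`). [cite: Brown1982CohomologyGroups, III §5 Prop. (5.8)] -/
theorem exists_mem_coordSummand_pi_eq (v : V) (i : I) : ∃ vi ∈ coordSummand π i, π i vi = π i v := by
  obtain ⟨vi, hvi⟩ := hbij.2 (Pi.single i (π i v))
  refine ⟨vi, (mem_coordSummand_iff π i vi).mpr fun j hj => ?_, ?_⟩
  · have h := congr_fun hvi j
    rwa [LinearMap.pi_apply, Pi.single_eq_of_ne hj] at h
  · have h := congr_fun hvi i
    rwa [LinearMap.pi_apply, Pi.single_eq_same] at h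

variable [Fintype I]

omit [MulAction G I] in
include hbij in
/-- ★ **`V = ⊕_i M_i`**: for a FINITE index set and `(π_i)_i : V → ∏_i A_i` bijective, the coordinate submodules form an internal direct sum
(independence: on `M_i ∩ Σ_{j≠i} M_j` every `π_j` vanishes; generation: `v = Σ_i v_i` with the coordinate lifts `v_i`).  With `coordSummand_map_le`
and transitivity this is the input of `shapiroEquiv` — Brown's (5.8) (product, co-induced) meets (5.3) (sum, induced) for finite index (5.9).
[cite: Brown1982CohomologyGroups, III §5 Prop. (5.3), (5.8), (5.9)] -/
theorem isInternal_coordSummand : DirectSum.IsInternal (coordSummand π) := by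
  refine DirectSum.isInternal_submodule_of_iSupIndep_of_iSup_eq_top ?_ ?_
  · -- independence
    rw [iSupIndep_def]
    intro i
    rw [disjoint_iff, eq_bot_iff]
    rintro v ⟨hvi, hvs⟩
    have hle : (⨆ (j : I) (_ : j ≠ i), coordSummand π j) ≤ LinearMap.ker (π i) := iSup₂_le fun j hj => coordSummand_le_ker π hj
    have h0 : π i v = 0 := LinearMap.mem_ker.mp (hle hvs)
    rw [Submodule.mem_bot]
    refine eq_zero_of_forall_pi_eq_zero π hbij fun j => ?_
    by_cases hj : j = i
    · subst hj; exact h0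
    · exact (mem_coordSummand_iff π i v).mp hvi j hj
  · -- generation
    rw [eq_top_iff]
    rintro v -
    choose w hwmem hwπ using fun i => exists_mem_coordSummand_pi_eq π hbij v i
    have hsum : v = ∑ i, w i := by
      rw [← sub_eq_zero]
      refine eq_zero_of_forall_pi_eq_zero π hbij fun j => ?_
      rw [map_sub, map_sum, Finset.sum_eq_single j (fun i _ hij => (mem_coordSummand_iff π i (w i)).mp (hwmem i) j hij.symm)
        (fun h => absurd (Finset.mem_univ j) h), hwπ, sub_self]
    rw [hsum]
    exact Submodule.sum_mem _ fun i _ => Submodule.mem_iSup_of_mem i (hwmem i)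

end Finite

/-! ## §2. Componentwise submodules `∏_i B_i` inherit the decomposition -/

variable (B : ∀ i, Submodule k (A i))

/-- **`∏_i B_i := ⋂_i π_i⁻¹(B_i) ≤ V`** — the elements all of whose coordinates lie in the given submodules (e.g. the PRINCIPAL semi-local units
`U(F) = ∏_w U¹_w` inside `∏_w 𝒪_wˣ`, Rubin 1991 §4). [cite: Brown1982CohomologyGroups, III §5 Prop. (5.8)] [cite: Harari2020, §13.1] -/
def piComap : Submodule k V := ⨅ i, (B i).comap (π i)

omit [MulAction G I] in
/-- Membership in `∏_i B_i`. [cite: Brown1982CohomologyGroups, III §5 Prop. (5.8)] -/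
theorem mem_piComap_iff (v : V) : v ∈ piComap π B ↔ ∀ i, π i v ∈ B i := by
  simp only [piComap, Submodule.mem_iInf, Submodule.mem_comap]

/-- **The restricted projections `∏_j B_j → B_i`.** [cite: Brown1982CohomologyGroups, III §5 Prop. (5.8)] -/
def piComapProj (i : I) : piComap π B →ₗ[k] B i :=
  LinearMap.codRestrict (B i) ((π i).comp (piComap π B).subtype) fun v => (mem_piComap_iff π B v).mp v.2 i

omit [MulAction G I] in
/-- `piComapProj i v = π_i v`. [cite: Brown1982CohomologyGroups, III §5 Prop. (5.8)] -/
@[simp] theorem coe_piComapProj (i : I) (v : piComap π B) : (piComapProj π B i v : A i) = π i v := rfl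

omit [MulAction G I] in
include hbij in
/-- ★ **`(∏_j B_j) ≅ ∏_j B_j`**: the restricted projections are again a bijective family. [cite: Brown1982CohomologyGroups, III §5 Prop. (5.8)] -/
theorem bijective_pi_piComapProj : Function.Bijective (LinearMap.pi (piComapProj π B)) := by
  constructor
  · intro x y h
    apply Subtype.ext
    apply hbij.1
    funext i
    have hi := congr_fun h i
    rw [LinearMap.pi_apply, LinearMap.pi_apply] at hi
    rw [LinearMap.pi_apply, LinearMap.pi_apply]
    exact congrArg Subtype.val hi
  · intro f
    obtain ⟨v, hv⟩ := hbij.2 fun i => (f i : A i)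
    have hvmem : v ∈ piComap π B := (mem_piComap_iff π B v).mpr fun i => by
      have h := congr_fun hv i
      rw [LinearMap.pi_apply] at h
      rw [h]; exact (f i).2
    refine ⟨⟨v, hvmem⟩, funext fun i => Subtype.ext ?_⟩
    have h := congr_fun hv i
    rw [LinearMap.pi_apply] at h
    rw [LinearMap.pi_apply, coe_piComapProj]
    exact h

variable (hB : ∀ (g : G) (i : I) (v : V), π i v ∈ B i → π (g • i) (N g v) ∈ B (g • i))

include hB in
/-- `∏_i B_i` is stable under `g` when `π_{g i}(g v) ∈ B_{g i}` whenever `π_i v ∈ B_i` (for the semi-local units: `σ_w(U¹_w) = U¹_{σ w}`).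
[cite: Brown1982CohomologyGroups, III §5 Prop. (5.8)] -/
theorem piComap_le_comap (g : G) : piComap π B ≤ (piComap π B).comap (N g) := fun v hv => by
  rw [Submodule.mem_comap, mem_piComap_iff]
  intro j
  have h := hB g (g⁻¹ • j) v ((mem_piComap_iff π B v).mp hv _)
  rwa [smul_inv_smul] at h

/-- **The restricted action on `∏_i B_i`.** [cite: Brown1982CohomologyGroups, III §5 Prop. (5.8)] -/
def piComapRep : Representation k G (piComap π B) :=
  N.subrepresentation (piComap π B) (piComap_le_comap N π B hB)

/-- `piComapRep g v = g v` in `V`. [cite: Brown1982CohomologyGroups, III §5 Prop. (5.8)] -/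
@[simp] theorem coe_piComapRep_apply (g : G) (v : piComap π B) : (piComapRep N π B hB g v : V) = N g v := rfl

include hker in
/-- ★ **`ker(π'_{g i} ∘ g) = ker π'_i` on `∏_j B_j`**: the permutation hypothesis is inherited by the restricted projections.
[cite: Brown1982CohomologyGroups, III §5 Prop. (5.8)] -/
theorem ker_piComapProj_comp_eq (g : G) (i : I) :
    LinearMap.ker (piComapProj π B (g • i) ∘ₗ piComapRep N π B hB g) = LinearMap.ker (piComapProj π B i) := by
  ext v
  have h := SetLike.ext_iff.mp (hker g i) (v : V)
  simp only [LinearMap.mem_ker, LinearMap.comp_apply] at h ⊢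
  rw [← Submodule.coe_eq_zero, ← Submodule.coe_eq_zero, coe_piComapProj, coe_piComapProj, coe_piComapRep_apply]
  exact h

end InducedModule

end Literature.Algebra.Homology

end
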